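import Mathlib
import HarnessLib
import Summits.HubbardSuperconductivity.HubbardSuperconductivity.Theorems.KLProgrammeC4aPPKernelTrueNumeratorFar
import Summits.HubbardSuperconductivity.HubbardSuperconductivity.Theorems.KLProgrammeC4aAntidiagonalFlatnessL1

/-!
# Route `KLProgramme` — crux C4a, S3 brick (B4) «(B4)-UMK1», «(M1)-TRUE-KERNEL» analytic half, part 2: the ANTI-DIAGONAL FLATNESS NUMBER OF THE TRUE
# pp PAIR KERNEL is `≤ κ₀·((10B₁ + 7/2)Λ + 2T + Λ/(1−t₁))/D²` — the true-kernel replacement of model B in p671506 §4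

Cell `gate-hubbard-kl`, seat hubbard-kl-k3c3-p1 (g15; row «δμ-flow with klAngularMean constant piece»).  Located brick for the (U1) chain of hubbard-kl-k3c3-p3 / the
(C)-closer lane (stub (C) `stub_twoLeg_curvature` of `KLRegimeEngineV17F2`, stmt-HubbardSuperconductivity-20437; note `M1-TRUE-KERNEL.md`, evidence #45).
MODEL OF RECORD (`…C4aPPKernelTrueNumerator`): `N(e,u) = (2/β)Σ_{n≥0} W(ωₙ,e)W(ωₙ,u)[e/(ωₙ²+e²) + u/(ωₙ²+u²)]`, above-scale Salmhofer weight at scale `Λ`, all fermionic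
frequencies, `Ω = 0`, `T = 1/β`; kernel `K(e,u) = N(e,u)·κ(e/(e+u))/(e+u)` with the finer-line split `κ ∈ C¹`, `|κ| ≤ κ₀` on `[0,1]`, `κ(t) = 0` for `t ≥ t₁` (`t₁ < 1`).
* §1 uniform bounds and continuity of the derivative series along the anti-diagonal `u = D − e` (`continuous_tsum` with the counting-free dominator);
* §2 **`hasDerivAt_ppTrueNumerator_line`** — `d/de N(e, D−e) = ∂ₑN − ∂ᵤN` by termwise differentiation of the ONE-variable series (no two-variable chain rule);
* §3 the exponential level integral `∫_a^b βx·e^{−βx} dx ≤ (a + 1/β)e^{−βa}` and `sech(y/2)² ≤ 4e^{−y}`;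
* §4 **`trueKernel_antidiagonal_flatness_le`** — for `Λ < (1 − t₁)·D`:
  `|∫_0^D ∂ᵤK(e, D−e) de| ≤ κ₀·((10B₁ + 7/2)·Λ + 2/β + Λ/(1 − t₁))/D²`,
  the instance of `abs_integral_antidiagonal_flatness_le_of_L1` with `M₁ ≤ κ₀((10B₁ + 5/2)Λ + Λ + 1/β)` (loop-level derivative: `(10B₁+5/2)/Λ` on `[0,Λ]`, the exact
  `(β/4)sech²(βe/2)` beyond) and `M₂ ≤ κ₀(1/β + Λ/(1−t₁))` (partner derivative: `(β/4)sech²(βu/2) + Λ/u²` on the split support `u ≥ (1−t₁)D > Λ`), and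
  `hasDerivAt_trueKernel_u` identifying the integrand with `∂ᵤK` (p671506 `hasDerivAt_ratioKernel_u`).
This is the (N2) flatness number `A_fl = A·lo/max(D,lo)²` for the TRUE kernel with `lo = Λ` and `A = κ₀(10B₁ + 7/2 + 2T/Λ + 1/(1−t₁))` — `lo/D²`-class, n-free, NO `log`
(float value of the note: `A ≈ 0.3κ₀`; the constant here is not optimised).  Pure real analysis; nothing asserts (C), K3 or superconductivity.
References: BGM 2006 §2.1, §2.4 [cite: BenfattoGiulianiMastropietro2006]; FST II CPAM 51 (1998) §3 [cite: FeldmanSalmhoferTrubowitz1998]; Salmhofer 1999 §4.5.3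
[cite: Salmhofer1999].
-/

noncomputable section

namespace Summit.HubbardSuperconductivity.HubbardSuperconductivity.Theorems.C4a

set_option linter.dupNamespace false -- summit = problem name (single-conjunct summit), D-0017

open Real Filter Set MeasureTheory intervalIntegral
open scoped Topology Interval
open Literature.MathematicalPhysics.QuantumLattice Literature.Analysis.SpecialFunctions

/-! ## §1 Uniform bounds and continuity along the anti-diagonal -/

/-- `|x/(ω² + x²)| ≤ 1/(2ω)` (`ω > 0`). [folklore] -/
theorem abs_lorentzian_le_half_inv {ω : ℝ} (hω : 0 < ω) (x : ℝ) : |x / (ω ^ 2 + x ^ 2)| ≤ 1 / (2 * ω) := by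
  rw [abs_div, abs_of_pos (by positivity : (0 : ℝ) < ω ^ 2 + x ^ 2), div_le_div_iff₀ (by positivity) (by positivity), one_mul]
  nlinarith [sq_nonneg (|x| - ω), sq_abs x, abs_nonneg x]

/-- `W(ω,·)` is continuous in the level. [cite: Salmhofer1999, §4.2.5 (4.70)] -/
theorem continuous_uvWeightFn_level (Λ ω : ℝ) : Continuous (uvWeightFn Λ ω) :=
  continuous_iff_continuousAt.2 fun x => (hasDerivAt_uvWeightFn Λ ω x).continuousAt

/-- `W′(ω,·)` is continuous in the level. [cite: Salmhofer1999, §4.2.5 (4.70)] -/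
theorem continuous_uvWeightFnD1_level (Λ ω : ℝ) : Continuous (uvWeightFnD1 Λ ω) :=
  continuous_iff_continuousAt.2 fun x => (hasDerivAt_uvWeightFnD1 Λ ω x).continuousAt

/-- The Lorentzian is continuous (`ω ≠ 0`). [folklore] -/
theorem continuous_lorentzian {ω : ℝ} (hω : ω ≠ 0) : Continuous fun x : ℝ => x / (ω ^ 2 + x ^ 2) :=
  continuous_id.div (continuous_const.add (continuous_pow 2)) fun x => by positivity

/-- The Lorentzian's derivative is continuous (`ω ≠ 0`). [folklore] -/
theorem continuous_lorentzian_deriv {ω : ℝ} (hω : ω ≠ 0) : Continuous fun x : ℝ => (ω ^ 2 - x ^ 2) / (ω ^ 2 + x ^ 2) ^ 2 :=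
  (continuous_const.sub (continuous_pow 2)).div ((continuous_const.add (continuous_pow 2)).pow 2) fun x => by positivity

/-- **The uniform bound of one summand of the derivative series**: for all levels `a, b`,
`|W(ωₙ,a)·[W′(ωₙ,b)(a/(ωₙ²+a²) + b/(ωₙ²+b²)) + W(ωₙ,b)(ωₙ²−b²)/(ωₙ²+b²)²]| ≤ (2B₁/Λ)(2Λ²/(ωₙ²+Λ²))(β/π) + 1/ωₙ²` (summable, `summable_ppDominator`).
[cite: BenfattoGiulianiMastropietro2006, §2.4 (2.36)] -/
theorem abs_ppDuSummand_le {β Λ : ℝ} (hβ : 0 < β) (hΛ : 0 < Λ) {B₁ : ℝ} (hB₁ : ∀ x, |deriv salmhoferCutoff x| ≤ B₁) (n : ℕ) (a b : ℝ) :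
    |uvWeightFn Λ (ppFreq β n) a * (uvWeightFnD1 Λ (ppFreq β n) b * (a / (ppFreq β n ^ 2 + a ^ 2) + b / (ppFreq β n ^ 2 + b ^ 2)) +
        uvWeightFn Λ (ppFreq β n) b * ((ppFreq β n ^ 2 - b ^ 2) / (ppFreq β n ^ 2 + b ^ 2) ^ 2))| ≤
      2 * B₁ / Λ * (2 * Λ ^ 2 / (ppFreq β n ^ 2 + Λ ^ 2)) * (β / π) + 1 / (ppFreq β n ^ 2 + 0 ^ 2) := by
  have hB0 := salmhoferB₁_nonneg hB₁
  have hω := ppFreq_pos hβ n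
  have hωπ : 1 / ppFreq β n ≤ β / π := by
    rw [div_le_div_iff₀ hω Real.pi_pos, one_mul]
    have := pi_div_le_ppFreq hβ n
    rw [div_le_iff₀ hβ] at this
    linarith
  have hLsum : |a / (ppFreq β n ^ 2 + a ^ 2) + b / (ppFreq β n ^ 2 + b ^ 2)| ≤ β / π := by
    refine (abs_add_le _ _).trans ?_
    calc |a / (ppFreq β n ^ 2 + a ^ 2)| + |b / (ppFreq β n ^ 2 + b ^ 2)| ≤ 1 / (2 * ppFreq β n) + 1 / (2 * ppFreq β n) :=
          add_le_add (abs_lorentzian_le_half_inv hω a) (abs_lorentzian_le_half_inv hω b)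
      _ = 1 / ppFreq β n := by field_simp; ring
      _ ≤ β / π := hωπ
  have hD1 := abs_uvWeightFnD1_le_shell hB₁ hΛ (ppFreq β n) b
  have hL' : |(ppFreq β n ^ 2 - b ^ 2) / (ppFreq β n ^ 2 + b ^ 2) ^ 2| ≤ 1 / (ppFreq β n ^ 2 + 0 ^ 2) := by
    rw [zero_pow two_ne_zero, add_zero]; exact abs_lorentzian_deriv_le hω.ne' b
  rw [abs_mul]
  calc |uvWeightFn Λ (ppFreq β n) a| *
        |uvWeightFnD1 Λ (ppFreq β n) b * (a / (ppFreq β n ^ 2 + a ^ 2) + b / (ppFreq β n ^ 2 + b ^ 2)) +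
          uvWeightFn Λ (ppFreq β n) b * ((ppFreq β n ^ 2 - b ^ 2) / (ppFreq β n ^ 2 + b ^ 2) ^ 2)|
      ≤ 1 * (2 * B₁ / Λ * (2 * Λ ^ 2 / (ppFreq β n ^ 2 + Λ ^ 2)) * (β / π) + 1 / (ppFreq β n ^ 2 + 0 ^ 2)) := by
        refine mul_le_mul (abs_uvWeightFn_le_one _ _ _) ?_ (abs_nonneg _) zero_le_one
        refine (abs_add_le _ _).trans (add_le_add ?_ ?_)
        · rw [abs_mul]; exact mul_le_mul hD1 hLsum (abs_nonneg _) (by positivity)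
        · rw [abs_mul]
          calc |uvWeightFn Λ (ppFreq β n) b| * |(ppFreq β n ^ 2 - b ^ 2) / (ppFreq β n ^ 2 + b ^ 2) ^ 2|
              ≤ 1 * (1 / (ppFreq β n ^ 2 + 0 ^ 2)) := mul_le_mul (abs_uvWeightFn_le_one _ _ _) hL' (abs_nonneg _) zero_le_one
            _ = 1 / (ppFreq β n ^ 2 + 0 ^ 2) := one_mul _
    _ = _ := one_mul _

/-- One summand of the derivative series is continuous along any affine reparametrisation of the two levels. [folklore] -/
theorem continuous_ppDuSummand {β Λ : ℝ} (hβ : 0 < β) (n : ℕ) {a b : ℝ → ℝ} (ha : Continuous a) (hb : Continuous b) :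
    Continuous fun x : ℝ => uvWeightFn Λ (ppFreq β n) (a x) *
      (uvWeightFnD1 Λ (ppFreq β n) (b x) * (a x / (ppFreq β n ^ 2 + a x ^ 2) + b x / (ppFreq β n ^ 2 + b x ^ 2)) +
        uvWeightFn Λ (ppFreq β n) (b x) * ((ppFreq β n ^ 2 - b x ^ 2) / (ppFreq β n ^ 2 + b x ^ 2) ^ 2)) := by
  have hω := (ppFreq_pos hβ n).ne'
  have hW := continuous_uvWeightFn_level Λ (ppFreq β n)
  have hW' := continuous_uvWeightFnD1_level Λ (ppFreq β n)
  have hL := continuous_lorentzian hω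
  have hL' := continuous_lorentzian_deriv hω
  exact (hW.comp ha).mul (((hW'.comp hb).mul ((hL.comp ha).add (hL.comp hb))).add ((hW.comp hb).mul (hL'.comp hb)))

/-- **The loop-level derivative along the anti-diagonal is continuous**: `e ↦ ∂ₑN(e, D−e) = ppTrueNumeratorDu β Λ (D−e) e`.
[cite: BenfattoGiulianiMastropietro2006, §2.4 (2.36)] -/
theorem continuous_ppTrueNumeratorDe_line {β Λ : ℝ} (hβ : 0 < β) (hΛ : 0 < Λ) {B₁ : ℝ} (hB₁ : ∀ x, |deriv salmhoferCutoff x| ≤ B₁) (D : ℝ) :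
    Continuous fun e : ℝ => ppTrueNumeratorDu β Λ (D - e) e := by
  unfold ppTrueNumeratorDu
  refine continuous_const.mul ?_
  exact continuous_tsum (fun n => continuous_ppDuSummand hβ n (continuous_const.sub continuous_id) continuous_id)
    (summable_ppDominator hβ B₁ (β / π)) fun n e => by rw [Real.norm_eq_abs]; exact abs_ppDuSummand_le hβ hΛ hB₁ n (D - e) e

/-- **The partner-level derivative along the anti-diagonal is continuous**: `e ↦ ∂ᵤN(e, D−e) = ppTrueNumeratorDu β Λ e (D−e)`.
[cite: BenfattoGiulianiMastropietro2006, §2.4 (2.36)] -/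
theorem continuous_ppTrueNumeratorDu_line {β Λ : ℝ} (hβ : 0 < β) (hΛ : 0 < Λ) {B₁ : ℝ} (hB₁ : ∀ x, |deriv salmhoferCutoff x| ≤ B₁) (D : ℝ) :
    Continuous fun e : ℝ => ppTrueNumeratorDu β Λ e (D - e) := by
  unfold ppTrueNumeratorDu
  refine continuous_const.mul ?_
  exact continuous_tsum (fun n => continuous_ppDuSummand hβ n continuous_id (continuous_const.sub continuous_id))
    (summable_ppDominator hβ B₁ (β / π)) fun n e => by rw [Real.norm_eq_abs]; exact abs_ppDuSummand_le hβ hΛ hB₁ n e (D - e)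

/-! ## §2 The derivative of the numerator along the anti-diagonal -/

/-- **`d/de N(e, D−e) = ∂ₑN(e,D−e) − ∂ᵤN(e,D−e)`** — termwise differentiation of the one-variable series `e ↦ N(e, D−e)` (dominator `2·dom`), then
`Σ(t₁ − t₂) = Σt₁ − Σt₂`. [cite: BenfattoGiulianiMastropietro2006, §2.4 (2.36)] -/
theorem hasDerivAt_ppTrueNumerator_line {β Λ : ℝ} (hβ : 0 < β) (hΛ : 0 < Λ) {B₁ : ℝ} (hB₁ : ∀ x, |deriv salmhoferCutoff x| ≤ B₁) (D e : ℝ) :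
    HasDerivAt (fun x : ℝ => ppTrueNumerator β Λ x (D - x)) (ppTrueNumeratorDu β Λ (D - e) e - ppTrueNumeratorDu β Λ e (D - e)) e := by
  have hω : ∀ n : ℕ, 0 < ppFreq β n := ppFreq_pos hβ
  -- the two term families
  set t₁ : ℕ → ℝ → ℝ := fun n x => uvWeightFn Λ (ppFreq β n) (D - x) *
      (uvWeightFnD1 Λ (ppFreq β n) x * ((D - x) / (ppFreq β n ^ 2 + (D - x) ^ 2) + x / (ppFreq β n ^ 2 + x ^ 2)) +
        uvWeightFn Λ (ppFreq β n) x * ((ppFreq β n ^ 2 - x ^ 2) / (ppFreq β n ^ 2 + x ^ 2) ^ 2)) with ht₁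
  set t₂ : ℕ → ℝ → ℝ := fun n x => uvWeightFn Λ (ppFreq β n) x *
      (uvWeightFnD1 Λ (ppFreq β n) (D - x) * (x / (ppFreq β n ^ 2 + x ^ 2) + (D - x) / (ppFreq β n ^ 2 + (D - x) ^ 2)) +
        uvWeightFn Λ (ppFreq β n) (D - x) * ((ppFreq β n ^ 2 - (D - x) ^ 2) / (ppFreq β n ^ 2 + (D - x) ^ 2) ^ 2)) with ht₂
  set dom : ℕ → ℝ := fun n => 2 * B₁ / Λ * (2 * Λ ^ 2 / (ppFreq β n ^ 2 + Λ ^ 2)) * (β / π) + 1 / (ppFreq β n ^ 2 + 0 ^ 2) with hdom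
  have hsdom : Summable dom := summable_ppDominator hβ B₁ (β / π)
  have hb₁ : ∀ n x, |t₁ n x| ≤ dom n := fun n x => abs_ppDuSummand_le hβ hΛ hB₁ n (D - x) x
  have hb₂ : ∀ n x, |t₂ n x| ≤ dom n := fun n x => abs_ppDuSummand_le hβ hΛ hB₁ n x (D - x)
  have hs₁ : ∀ x, Summable fun n => t₁ n x := fun x => Summable.of_norm_bounded hsdom fun n => by rw [Real.norm_eq_abs]; exact hb₁ n x
  have hs₂ : ∀ x, Summable fun n => t₂ n x := fun x => Summable.of_norm_bounded hsdom fun n => by rw [Real.norm_eq_abs]; exact hb₂ n x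
  -- termwise differentiation of the series
  have hser : HasDerivAt (fun x : ℝ => ∑' n : ℕ, uvWeightFn Λ (ppFreq β n) x * uvWeightFn Λ (ppFreq β n) (D - x) *
      (x / (ppFreq β n ^ 2 + x ^ 2) + (D - x) / (ppFreq β n ^ 2 + (D - x) ^ 2))) (∑' n : ℕ, (t₁ n e - t₂ n e)) e := by
    refine hasDerivAt_tsum (u := fun n => dom n + dom n)
      (g := fun (n : ℕ) (x : ℝ) => uvWeightFn Λ (ppFreq β n) x * uvWeightFn Λ (ppFreq β n) (D - x) *
        (x / (ppFreq β n ^ 2 + x ^ 2) + (D - x) / (ppFreq β n ^ 2 + (D - x) ^ 2)))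
      (g' := fun n x => t₁ n x - t₂ n x) (hsdom.add hsdom) (fun n x => ?_) (fun n x => ?_) (y₀ := 0) ?_ e
    · -- derivative of one term: product of `W(ω,x)`, `W(ω,D−x)` and the Lorentzian sum
      have hA : HasDerivAt (fun y => uvWeightFn Λ (ppFreq β n) y) (uvWeightFnD1 Λ (ppFreq β n) x) x := hasDerivAt_uvWeightFn Λ (ppFreq β n) x
      have hB : HasDerivAt (fun y => uvWeightFn Λ (ppFreq β n) (D - y)) (-uvWeightFnD1 Λ (ppFreq β n) (D - x)) x := by
        have h := (hasDerivAt_uvWeightFn Λ (ppFreq β n) (D - x)).comp x ((hasDerivAt_id x).const_sub D)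
        refine (h.congr_of_eventuallyEq (Eventually.of_forall fun y => rfl)).congr_deriv ?_
        simp
      have hC1 : HasDerivAt (fun y : ℝ => y / (ppFreq β n ^ 2 + y ^ 2)) ((ppFreq β n ^ 2 - x ^ 2) / (ppFreq β n ^ 2 + x ^ 2) ^ 2) x :=
        hasDerivAt_lorentzian (ppFreq β n) (by have := hω n; positivity)
      have hC2 : HasDerivAt (fun y : ℝ => (D - y) / (ppFreq β n ^ 2 + (D - y) ^ 2))
          (-((ppFreq β n ^ 2 - (D - x) ^ 2) / (ppFreq β n ^ 2 + (D - x) ^ 2) ^ 2)) x := by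
        have h := (hasDerivAt_lorentzian (ppFreq β n) (x := D - x) (by have := hω n; positivity)).comp x ((hasDerivAt_id x).const_sub D)
        refine (h.congr_of_eventuallyEq (Eventually.of_forall fun y => rfl)).congr_deriv ?_
        simp
      have h := (hA.fun_mul hB).fun_mul (hC1.fun_add hC2)
      refine (h.congr_of_eventuallyEq (Eventually.of_forall fun y => by ring)).congr_deriv ?_
      simp only [ht₁, ht₂]
      ring
    · rw [Real.norm_eq_abs]
      exact (abs_sub _ _).trans (add_le_add (hb₁ n x) (hb₂ n x))
    · -- convergence at `0`
      refine Summable.of_norm_bounded ((summable_one_div_ppFreq_sq_add_sq hβ 0).mul_left |D|) fun n => ?_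
      rw [Real.norm_eq_abs, zero_div, zero_add, sub_zero, abs_mul, abs_mul, zero_pow two_ne_zero, add_zero]
      have h1 := abs_lorentzian_le_abs_div_sq (hω n).ne' D
      calc |uvWeightFn Λ (ppFreq β n) 0| * |uvWeightFn Λ (ppFreq β n) D| * |D / (ppFreq β n ^ 2 + D ^ 2)| ≤ 1 * 1 * (|D| / ppFreq β n ^ 2) :=
            mul_le_mul (mul_le_mul (abs_uvWeightFn_le_one _ _ _) (abs_uvWeightFn_le_one _ _ _) (abs_nonneg _) zero_le_one) h1 (abs_nonneg _)
              (by positivity)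
        _ = |D| * (1 / ppFreq β n ^ 2) := by ring
  -- split the derivative series and restore the factor `2/β`
  rw [(hs₁ e).tsum_sub (hs₂ e)] at hser
  have hfun : (fun x : ℝ => ppTrueNumerator β Λ x (D - x)) = fun x => 2 / β * ∑' n : ℕ, uvWeightFn Λ (ppFreq β n) x * uvWeightFn Λ (ppFreq β n) (D - x) *
      (x / (ppFreq β n ^ 2 + x ^ 2) + (D - x) / (ppFreq β n ^ 2 + (D - x) ^ 2)) := by
    funext x; rfl
  rw [hfun]
  have h := hser.const_mul (2 / β)
  refine h.congr_deriv ?_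
  simp only [ppTrueNumeratorDu, ht₁, ht₂]
  ring

/-! ## §3 Two elementary majorant integrals -/

/-- `sech(y/2)² ≤ 4e^{−y}` for `y ≥ 0`. [folklore] -/
theorem sech_half_sq_le_four_exp_neg {y : ℝ} (hy : 0 ≤ y) : sech (y / 2) ^ 2 ≤ 4 * Real.exp (-y) := by
  have hs := sech_le_two_mul_exp_neg_abs (y / 2)
  have hs0 := (sech_pos (y / 2)).le
  have h := pow_le_pow_left₀ hs0 hs 2
  rw [abs_of_nonneg (by linarith : 0 ≤ y / 2)] at h
  calc sech (y / 2) ^ 2 ≤ (2 * Real.exp (-(y / 2))) ^ 2 := h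
    _ = 4 * (Real.exp (-(y / 2)) * Real.exp (-(y / 2))) := by ring
    _ = 4 * Real.exp (-y) := by rw [← Real.exp_add]; ring_nf

/-- **`∫_a^b βx·e^{−βx} dx ≤ (a + 1/β)·e^{−βa}`** for `0 < β`, `a ≤ b` (primitive `−(x + 1/β)e^{−βx}`). [folklore] -/
theorem integral_mul_exp_neg_mul_le {β a b : ℝ} (hβ : 0 < β) (ha : 0 ≤ a) (hab : a ≤ b) :
    ∫ x in a..b, β * x * Real.exp (-(β * x)) ≤ (a + 1 / β) * Real.exp (-(β * a)) := by
  have hderiv : ∀ x ∈ uIcc a b, HasDerivAt (fun x : ℝ => -(x + 1 / β) * Real.exp (-(β * x))) (β * x * Real.exp (-(β * x))) x := by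
    intro x _
    have h1 : HasDerivAt (fun x : ℝ => -(x + 1 / β)) (-1) x := by
      have h := ((hasDerivAt_id x).add_const (1 / β)).neg
      refine (h.congr_of_eventuallyEq (Eventually.of_forall fun y => ?_)).congr_deriv (by simp)
      simp
    have h2 : HasDerivAt (fun x : ℝ => Real.exp (-(β * x))) (Real.exp (-(β * x)) * (-β)) x := by
      have h := ((hasDerivAt_id x).const_mul β).neg.exp
      refine (h.congr_of_eventuallyEq (Eventually.of_forall fun y => by simp)).congr_deriv ?_
      simp
    have h := h1.mul h2
    refine h.congr_deriv ?_
    field_simp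
    ring
  have hint : IntervalIntegrable (fun x : ℝ => β * x * Real.exp (-(β * x))) volume a b :=
    ((continuous_const.mul continuous_id).mul (continuous_exp.comp (continuous_const.mul continuous_id).neg)).intervalIntegrable _ _
  rw [integral_eq_sub_of_hasDerivAt hderiv hint]
  have hb : 0 ≤ b := ha.trans hab
  have hpos : 0 ≤ (b + 1 / β) * Real.exp (-(β * b)) := by positivity
  linarith

/-! ## §4 The flatness number of the true kernel -/

/-- **The integrand IS `∂ᵤK`**: with `K(e,u) = N(e,u)·κ(e/(e+u))/(e+u)`, at `u = D − e` (`D ≠ 0`) the `u`-derivative of `K(e,·)` is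
`∂ᵤN·κ(e/D)/D − N·(κ′(e/D)(e/D) + κ(e/D))/D²` (p671506 `hasDerivAt_ratioKernel_u` with `hasDerivAt_ppTrueNumerator_u`). [cite: FeldmanSalmhoferTrubowitz1998, §3] -/
theorem hasDerivAt_trueKernel_u {β Λ : ℝ} (hβ : 0 < β) (hΛ : 0 < Λ) {B₁ : ℝ} (hB₁ : ∀ x, |deriv salmhoferCutoff x| ≤ B₁) {κ κ' : ℝ → ℝ}
    (hκ : ∀ t, HasDerivAt κ (κ' t) t) {D : ℝ} (hD : D ≠ 0) (e : ℝ) :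
    HasDerivAt (fun u : ℝ => ppTrueNumerator β Λ e u * κ (e / (e + u)) / (e + u))
      (ppTrueNumeratorDu β Λ e (D - e) * κ (e / D) / D - ppTrueNumerator β Λ e (D - e) * (κ' (e / D) * (e / D) + κ (e / D)) / D ^ 2) (D - e) := by
  have hs : e + (D - e) ≠ 0 := by rw [add_sub_cancel]; exact hD
  have h := hasDerivAt_ratioKernel_u (Nu := fun u => ppTrueNumerator β Λ e u) (κ := κ) (e := e) (u := D - e) hs
    (hasDerivAt_ppTrueNumerator_u hβ hΛ hB₁ e (D - e)) (hκ _)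
  have hsD : e + (D - e) = D := by ring
  rw [hsD] at h
  exact h

/-- **THE ANTI-DIAGONAL FLATNESS NUMBER OF THE TRUE pp PAIR KERNEL.**  `0 < β`, `0 < Λ`, `|χ′| ≤ B₁`; split profile `κ ∈ C¹` with `|κ| ≤ κ₀` on `[0,1]` and
`κ(t) = 0` for `t ≥ t₁`, `0 ≤ t₁ < 1`; anti-diagonal level `D` with `Λ < (1 − t₁)·D` (the partner line is above the shell wherever the split lives).  THEN
`|∫_0^D [∂ᵤN(e,D−e)·κ(e/D)/D − N(e,D−e)·(κ′(e/D)(e/D) + κ(e/D))/D²] de| ≤ κ₀·((10B₁ + 7/2)·Λ + 2/β + Λ/(1 − t₁))/D²`.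
[cite: FeldmanSalmhoferTrubowitz1998, §3] -/
theorem trueKernel_antidiagonal_flatness_le {β Λ : ℝ} (hβ : 0 < β) (hΛ : 0 < Λ) {B₁ : ℝ} (hB₁ : ∀ x, |deriv salmhoferCutoff x| ≤ B₁)
    {κ κ' : ℝ → ℝ} {κ₀ t₁ D : ℝ} (hκ : ∀ t, HasDerivAt κ (κ' t) t) (hκ'c : Continuous κ') (hκb : ∀ t ∈ Icc 0 1, |κ t| ≤ κ₀) (hκ₀ : 0 ≤ κ₀)
    (ht₀ : 0 ≤ t₁) (ht₁ : t₁ < 1) (hκs : ∀ t, t₁ ≤ t → κ t = 0) (hD : Λ < (1 - t₁) * D) :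
    |∫ e in (0 : ℝ)..D, (ppTrueNumeratorDu β Λ e (D - e) * κ (e / D) / D -
        ppTrueNumerator β Λ e (D - e) * (κ' (e / D) * (e / D) + κ (e / D)) / D ^ 2)| ≤
      κ₀ * ((10 * B₁ + 7 / 2) * Λ + 2 / β + Λ / (1 - t₁)) / D ^ 2 := by
  have hB0 := salmhoferB₁_nonneg hB₁
  have h1t : 0 < 1 - t₁ := by linarith
  have hDpos : 0 < D := by
    by_contra h
    have : (1 - t₁) * D ≤ 0 := mul_nonpos_of_nonneg_of_nonpos h1t.le (not_lt.1 h)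
    linarith
  have hΛD : Λ < D := hD.trans_le (by nlinarith)
  set u₀ : ℝ := (1 - t₁) * D with hu₀
  have hu₀Λ : Λ < u₀ := hD
  -- the far region on the split's support: `κ(e/D) ≠ 0 ⟹ u₀ < D − e`
  have hfar : ∀ e ∈ Icc (0 : ℝ) D, κ (e / D) ≠ 0 → u₀ < D - e := fun e he hκe => by
    have hlt : e / D < t₁ := by
      by_contra h
      exact hκe (hκs _ (not_lt.1 h))
    rw [div_lt_iff₀ hDpos] at hlt
    rw [hu₀]; nlinarith
  have hκe : ∀ e ∈ Icc (0 : ℝ) D, |κ (e / D)| ≤ κ₀ := fun e he =>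
    hκb (e / D) ⟨div_nonneg he.1 hDpos.le, (div_le_one hDpos).2 he.2⟩
  -- the line functions
  set n : ℝ → ℝ := fun e => ppTrueNumerator β Λ e (D - e) with hn
  set n₁ : ℝ → ℝ := fun e => ppTrueNumeratorDu β Λ (D - e) e with hn₁
  set n₂ : ℝ → ℝ := fun e => ppTrueNumeratorDu β Λ e (D - e) with hn₂
  have hnd : ∀ e ∈ Icc (0 : ℝ) D, HasDerivAt n (n₁ e - n₂ e) e := fun e _ => hasDerivAt_ppTrueNumerator_line hβ hΛ hB₁ D e
  have hn₁c : Continuous n₁ := continuous_ppTrueNumeratorDe_line hβ hΛ hB₁ D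
  have hn₂c : Continuous n₂ := continuous_ppTrueNumeratorDu_line hβ hΛ hB₁ D
  have hbd : n D * κ 1 = 0 := by rw [hκs 1 ht₁.le, mul_zero]
  have hκcont : Continuous κ := continuous_iff_continuousAt.2 fun t => (hκ t).continuousAt
  have hκDc : Continuous fun e : ℝ => κ (e / D) := hκcont.comp (continuous_id.div_const D)
  -- M₁: the loop-level derivative
  have hp₁lo : ∀ e ∈ Ι (0 : ℝ) Λ, ‖|n₁ e * κ (e / D)| * e‖ ≤ κ₀ * (10 * B₁ + 5 / 2) := fun e he => by
    rw [uIoc_of_le hΛ.le] at he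
    have heD : e ∈ Icc (0 : ℝ) D := ⟨he.1.le, he.2.trans hΛD.le⟩
    rw [Real.norm_eq_abs, abs_mul, abs_abs, abs_of_nonneg he.1.le, abs_mul]
    by_cases hκ0 : κ (e / D) = 0
    · rw [hκ0, abs_zero, mul_zero, zero_mul]; positivity
    · have hu : Λ < D - e := hu₀Λ.trans (hfar e heD hκ0)
      have hb := abs_ppTrueNumeratorDe_far_le hβ hΛ hu hB₁ e
      calc |n₁ e| * |κ (e / D)| * e ≤ (10 * B₁ + 5 / 2) / Λ * κ₀ * Λ :=
            mul_le_mul (mul_le_mul hb (hκe e heD) (abs_nonneg _) (by positivity)) he.2 he.1.le (by positivity)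
        _ = κ₀ * (10 * B₁ + 5 / 2) := by field_simp
  have hp₁hi : ∀ e ∈ Ι Λ D, |n₁ e * κ (e / D)| * e ≤ κ₀ * (β * e * Real.exp (-(β * e))) := fun e he => by
    rw [uIoc_of_le hΛD.le] at he
    have heD : e ∈ Icc (0 : ℝ) D := ⟨hΛ.le.trans he.1.le, he.2⟩
    have he0 : 0 ≤ e := hΛ.le.trans he.1.le
    rw [abs_mul]
    by_cases hκ0 : κ (e / D) = 0
    · rw [hκ0, abs_zero, mul_zero, zero_mul]; positivity
    · have hu : Λ < D - e := hu₀Λ.trans (hfar e heD hκ0)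
      have hex : n₁ e = β / 4 * sech (β * e / 2) ^ 2 := ppTrueNumeratorDe_of_far_of_far hβ hΛ hu he.1
      have hsech : sech (β * e / 2) ^ 2 ≤ 4 * Real.exp (-(β * e)) := sech_half_sq_le_four_exp_neg (by positivity)
      rw [hex, abs_of_nonneg (by positivity : (0 : ℝ) ≤ β / 4 * sech (β * e / 2) ^ 2)]
      calc β / 4 * sech (β * e / 2) ^ 2 * |κ (e / D)| * e ≤ β / 4 * (4 * Real.exp (-(β * e))) * κ₀ * e := by
            gcongr
            · exact hκe e heD
        _ = κ₀ * (β * e * Real.exp (-(β * e))) := by ring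
  have hi₁ : ∀ a b : ℝ, IntervalIntegrable (fun e => |n₁ e * κ (e / D)| * e) volume a b := fun a b =>
    (((hn₁c.mul hκDc).abs).mul continuous_id).intervalIntegrable _ _
  have hM₁ : ∫ e in (0 : ℝ)..D, |n₁ e * κ (e / D)| * e ≤ κ₀ * ((10 * B₁ + 5 / 2) * Λ + Λ + 1 / β) := by
    rw [← integral_add_adjacent_intervals (hi₁ 0 Λ) (hi₁ Λ D)]
    have hlo := intervalIntegral.norm_integral_le_of_norm_le_const hp₁lo
    rw [Real.norm_eq_abs, sub_zero, abs_of_pos hΛ] at hlo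
    have hlo' : ∫ e in (0 : ℝ)..Λ, |n₁ e * κ (e / D)| * e ≤ κ₀ * (10 * B₁ + 5 / 2) * Λ := (le_abs_self _).trans hlo
    have hhi : ∫ e in Λ..D, |n₁ e * κ (e / D)| * e ≤ ∫ e in Λ..D, κ₀ * (β * e * Real.exp (-(β * e))) :=
      intervalIntegral.integral_mono_on_of_le_Ioo hΛD.le (hi₁ Λ D)
        ((continuous_const.mul ((continuous_const.mul continuous_id).mul (continuous_exp.comp (continuous_const.mul continuous_id).neg))).intervalIntegrable _ _)
        fun e he => hp₁hi e (by rw [uIoc_of_le hΛD.le]; exact ⟨he.1, he.2.le⟩)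
    have hexp := integral_mul_exp_neg_mul_le hβ hΛ.le hΛD.le
    rw [intervalIntegral.integral_const_mul] at hhi
    have hexp' : (Λ + 1 / β) * Real.exp (-(β * Λ)) ≤ Λ + 1 / β := by
      have h1 : Real.exp (-(β * Λ)) ≤ 1 := Real.exp_le_one_iff.2 (by nlinarith)
      have h2 : 0 ≤ Λ + 1 / β := by positivity
      nlinarith
    nlinarith [hlo', hhi, hexp, hexp', hκ₀]
  -- M₂: the partner-level derivative
  have hp₂ : ∀ e ∈ Icc (0 : ℝ) D, |n₂ e * κ (e / D)| * (D - e) ≤ κ₀ * (β * (D - e) * Real.exp (-(β * (D - e))) + Λ / u₀) := fun e he => by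
    have hue : 0 ≤ D - e := by linarith [he.2]
    rw [abs_mul]
    by_cases hκ0 : κ (e / D) = 0
    · rw [hκ0, abs_zero, mul_zero, zero_mul]; positivity
    · have hu0 : u₀ < D - e := hfar e he hκ0
      have hu : Λ < D - e := hu₀Λ.trans hu0
      have hupos : 0 < D - e := hΛ.trans hu
      have hb := abs_ppTrueNumeratorDu_far_le hβ hΛ hu e
      have hsech : sech (β * (D - e) / 2) ^ 2 ≤ 4 * Real.exp (-(β * (D - e))) := sech_half_sq_le_four_exp_neg (by positivity)
      have hΛu : Λ / (D - e) ^ 2 * (D - e) ≤ Λ / u₀ := by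
        rw [div_mul_eq_mul_div, show Λ * (D - e) / (D - e) ^ 2 = Λ / (D - e) by field_simp]
        exact div_le_div_of_nonneg_left hΛ.le (hΛ.trans hu₀Λ) hu0.le
      calc |n₂ e| * |κ (e / D)| * (D - e) ≤ (β / 4 * sech (β * (D - e) / 2) ^ 2 + Λ / (D - e) ^ 2) * κ₀ * (D - e) :=
            mul_le_mul_of_nonneg_right (mul_le_mul hb (hκe e he) (abs_nonneg _) (by positivity)) hue
        _ = κ₀ * (β / 4 * sech (β * (D - e) / 2) ^ 2 * (D - e) + Λ / (D - e) ^ 2 * (D - e)) := by ring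
        _ ≤ κ₀ * (β / 4 * (4 * Real.exp (-(β * (D - e)))) * (D - e) + Λ / u₀) := by gcongr
        _ = κ₀ * (β * (D - e) * Real.exp (-(β * (D - e))) + Λ / u₀) := by ring
  have hi₂ : IntervalIntegrable (fun e => |n₂ e * κ (e / D)| * (D - e)) volume 0 D :=
    (((hn₂c.mul hκDc).abs).mul (continuous_const.sub continuous_id)).intervalIntegrable _ _
  have hM₂ : ∫ e in (0 : ℝ)..D, |n₂ e * κ (e / D)| * (D - e) ≤ κ₀ * (1 / β + Λ / (1 - t₁)) := by
    have hgc : Continuous fun e : ℝ => κ₀ * (β * (D - e) * Real.exp (-(β * (D - e))) + Λ / u₀) :=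
      continuous_const.mul (((continuous_const.mul (continuous_const.sub continuous_id)).mul
        (continuous_exp.comp (continuous_const.mul (continuous_const.sub continuous_id)).neg)).add continuous_const)
    have hmono : ∫ e in (0 : ℝ)..D, |n₂ e * κ (e / D)| * (D - e) ≤ ∫ e in (0 : ℝ)..D, κ₀ * (β * (D - e) * Real.exp (-(β * (D - e))) + Λ / u₀) :=
      intervalIntegral.integral_mono_on hDpos.le hi₂ (hgc.intervalIntegrable _ _) fun e he => hp₂ e he
    refine hmono.trans ?_
    rw [intervalIntegral.integral_const_mul]
    refine mul_le_mul_of_nonneg_left ?_ hκ₀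
    have hfI : IntervalIntegrable (fun e : ℝ => β * (D - e) * Real.exp (-(β * (D - e)))) volume 0 D :=
      ((continuous_const.mul (continuous_const.sub continuous_id)).mul
        (continuous_exp.comp (continuous_const.mul (continuous_const.sub continuous_id)).neg)).intervalIntegrable _ _
    have hgI : IntervalIntegrable (fun _ : ℝ => Λ / u₀) volume 0 D := continuous_const.intervalIntegrable _ _
    rw [intervalIntegral.integral_add hfI hgI, intervalIntegral.integral_const, smul_eq_mul, sub_zero]
    have hsub : ∫ e in (0 : ℝ)..D, β * (D - e) * Real.exp (-(β * (D - e))) = ∫ u in (0 : ℝ)..D, β * u * Real.exp (-(β * u)) := by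
      have h := intervalIntegral.integral_comp_sub_left (fun u : ℝ => β * u * Real.exp (-(β * u))) D (a := 0) (b := D)
      rw [sub_self, sub_zero] at h
      exact h
    rw [hsub]
    have hexp := integral_mul_exp_neg_mul_le hβ le_rfl hDpos.le
    rw [zero_add, mul_zero, neg_zero, Real.exp_zero, mul_one] at hexp
    have hu₀D : D * (Λ / u₀) = Λ / (1 - t₁) := by rw [hu₀]; field_simp
    rw [hu₀D]
    linarith
  -- the abstract weighted-L¹ flatness lemma
  have hmain := abs_integral_antidiagonal_flatness_le_of_L1 (n := n) (n₁ := n₁) (n₂ := n₂) (κ := κ) (κ' := κ')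
    (Ku := fun e => n₂ e * κ (e / D) / D - n e * (κ' (e / D) * (e / D) + κ (e / D)) / D ^ 2)
    hDpos hnd hn₁c hn₂c hκ hκ'c hbd (fun e _ => rfl) hM₁ hM₂
  refine hmain.trans (le_of_eq ?_)
  congr 1
  ring

end Summit.HubbardSuperconductivity.HubbardSuperconductivity.Theorems.C4a

end
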